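import Summits.Ventures.KdS.RouteWRebind
import Summits.Ventures.KdS.RouteWRealAxis
import HarnessLib

/-!
# Venture KdS — the closed-half-plane box theorems WITHOUT the cited fact H1′: the real axis by
# route W (`RouteW.realAxis_vanishing_lt_one`)

HONEST FRAMING (venture `Summits/Ventures/KdS`, cell `pub-kds`, seat LIT-1 g7): theorems only, a
SEPARATE file (no in-place edit of `ClosedHalfPlane310.lean` / `RouteWRebind.lean`). The landed
closed-half-plane `_310` theorems bind the cited fact H1′ `CasalsTeixeiraDaCosta2022_theorem310`
through its real-axis bullet only (`not_hasMode_real_of_fact_310`). Here are the `_routeWReal` TWINS of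
the `_ofA_` layer of `ClosedHalfPlane310.lean` in which that bullet is replaced by the route-W theorem
`RouteW.realAxis_vanishing_lt_one` (`RouteWRealAxis.lean`: Casals–Teixeira da Costa's Theorem 3.10,
proof Step 2 at `Im ω = 0`, PROVED in `KerrDeSitterHiddenSymmetryRealAxis.lean`, composed with
`Transfer`, `GaugeGlue` — landed — and K_B `EulerRLNonRes`). The binder `(h1 : …theorem310)` is thus
DELETED (route W's K_B is the theorem `RouteW.eulerRLNonRes_holds`, `RouteWEulerRL.lean`): the
`_ofA_routeWReal` layer carries NO cited fact and NO open hypothesis beyond the abstract `StatementA`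
inputs, and the assembled `_routeWReal` twins take those from the fact-free `_routeW` substrate of
`RouteWRebind.lean` (`statementA_routeW`, `statementAScalar_routeW`) — so `b0TheoremClosed_routeWReal :
R3_B0Certificates → B0TheoremClosed` and `noModeClosed_atlas_routeWReal hWC hη hdata` hold from the
signed certificates / DATA and the kernel-checked window constants ALONE.
Same records, same window constants, same statement shapes `StatementAReal` / `MSTruncClosed` /
`MSTruncClosedScalar` / `B0TheoremClosed`; `ω = 0` at `m = 0` from the hypothesis-free
`not_hasMode_zeroFreq` as before. Nothing of the real axis enters the `Im ω > 0` chain.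

References: M. Casals, R. Teixeira da Costa, Commun. Math. Phys. 394 (2022) 797–832
[CasalsTeixeiradacosta2022], Thm 3.10 (second bullet; proof Step 2, the case `Im ω = 0`).
-/

noncomputable section

open Set Complex

namespace Summit.Ventures.KdS

open Literature.Geometry.Lorentzian Literature.Geometry.Lorentzian.KerrDeSitter

/-! ### The real-axis bullet for a genuine mode, by route W -/

/-- **No real-frequency mode off the window, by route W** (twin of `not_hasMode_real_of_fact_310`
with `h1` deleted): on subextremal Kerr–de Sitter with `0 ≤ a`, for `s < 1`, real `ω ≠ 0`
and `m = 0 ∨ ω/m ∉ (Ω_low, Ω_SR)`, there is no spin-`s` mode (`λ̄ ∈ ℝ` for a genuine mode by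
`lambdaBar_im_eq_zero_of_real`; no threshold-ray condition and no `|a| < 3/Λ` needed).
[cite: CasalsTeixeiradacosta2022, Theorem 3.10 (second bullet)] -/
theorem not_hasMode_real_of_routeWReal {M a Λ s : ℝ} {ω : ℂ} {m : ℝ}
    (hsub : IsSubextremal M a Λ) (ha : 0 ≤ a) (hs : s < 1) (hω0 : ω ≠ 0) (hω : ω.im = 0)
    (hthird : m = 0 ∨
      ¬(superradiantLower M a Λ < ω.re / m ∧ ω.re / m < superradiantUpper M a Λ)) :
    ¬HasMode M a Λ s ω m := by
  rintro ⟨lam, R, hang, hrad, hin, hout, hnt⟩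
  obtain ⟨r, hr, hne⟩ := hnt
  exact hne (RouteW.realAxis_vanishing_lt_one hsub ha hs hω hω0
    (lambdaBar_im_eq_zero_of_real hsub.2.1.le hω hang) hthird hrad hin hout r hr)

/-- **COVERAGE on the real axis from route W and (H4)**, any box, table and spin `s < 1`: off the
closed window `|Re ω| > R_m ≥ |m|·Ω_SR ≥ 0`, so `ω ≠ 0` and `ω/m ∉ (Ω_low, Ω_SR)` (or `m = 0`); route W
excludes a mode. Twin of `statementAReal_of_310` with `h1` deleted (no `2s ∈ ℤ` needed).
[cite: CasalsTeixeiradacosta2022, Theorem 3.10 (second bullet)] -/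
theorem statementAReal_of_routeWReal {B : Set (ℝ × ℝ × ℝ)} {T : WindowTable} {s : ℝ}
    (h4 : WindowConstants B T) (hs : s < 1) : StatementAReal B T s := by
  intro p hp ω m hq _hk
  obtain ⟨hIm, hm2, hR⟩ := hq
  obtain ⟨hsub, hapos, -, -, -, -, hconst⟩ := h4 p hp
  obtain ⟨hΩ, -, -⟩ := hconst m hm2
  have hlow := superradiantLower_pos hsub hapos
  have hup := superradiantUpper_pos hsub hapos
  have hR0 : 0 ≤ T.R m := (mul_nonneg (abs_nonneg m) hup.le).trans hΩ
  have hω0 : ω ≠ 0 := by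
    intro h
    rw [h, Complex.zero_re, abs_zero] at hR
    exact (not_lt.mpr hR0) hR
  refine not_hasMode_real_of_routeWReal hsub hapos.le hs hω0 hIm ?_
  by_cases hm0 : m = 0
  · exact Or.inl hm0
  · refine Or.inr ?_
    rintro ⟨hlo, hhi⟩
    have hmpos : 0 < |m| := abs_pos.mpr hm0
    have hratio : 0 < ω.re / m := hlow.trans hlo
    have habs : |ω.re| / |m| < superradiantUpper p.1 p.2.1 p.2.2 := by
      rw [← abs_div, abs_of_pos hratio]; exact hhi
    have hlt : |ω.re| < |m| * superradiantUpper p.1 p.2.1 p.2.2 :=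
      lt_of_lt_of_eq ((div_lt_iff₀ hmpos).mp habs) (mul_comm _ _)
    linarith

/-- The scalar column at `m = 0` on the WHOLE real axis, `ω = 0` included — twin of
`statementARealZero_of_310` with `h1` deleted: real `ω ≠ 0` by route W with `m = 0`, and
`ω = 0` by the hypothesis-free zero-frequency theorem `not_hasMode_zeroFreq`.
[cite: CasalsTeixeiradacosta2022, Theorem 3.10 (second bullet)] -/
theorem statementARealZero_of_routeWReal {B : Set (ℝ × ℝ × ℝ)} {T : WindowTable}
    (h4 : WindowConstants B T) :
    ∀ p ∈ B, NoModeIn p.1 p.2.1 p.2.2 0 {q | q.1.im = 0 ∧ q.2 = 0} := by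
  intro p hp ω m hq _hk
  obtain ⟨hIm, hm0⟩ := hq
  obtain ⟨hsub, hapos, -⟩ := h4 p hp
  by_cases hω0 : ω = 0
  · subst hω0
    exact not_hasMode_zeroFreq hsub m
  · exact not_hasMode_real_of_routeWReal hsub hapos.le (by norm_num) hω0 hIm (Or.inl hm0)

/-! ### MS_trunc on the closed half-plane from Statement A and route W on the real axis -/

/-- **`s = -2`, closed half-plane, real axis by route W:** from Statement A off the window
(`Im ω > 0`, abstract), route W on the real axis, the window constants and the records'
Statement B̄ (`η ≥ 0`). Twin of `msTruncClosed_ofA_310`.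
[cite: CasalsTeixeiradacosta2022, Theorem 3.10 (second bullet)] -/
theorem msTruncClosed_ofA_routeWReal {B : Set (ℝ × ℝ × ℝ)} {T : WindowTable} {η : ℝ}
    {Λs : ℝ → ℝ → ℂ → ℝ → Set ℂ}
    (hA : StatementA B T) (h4 : WindowConstants B T) (hη : 0 ≤ η) (hB : StatementBbar B T η Λs) :
    MSTruncClosed B T Λs := by
  intro p hp
  obtain ⟨-, -, -, -, ⟨-, -, hk2, -⟩, hkap, -⟩ := h4 p hp
  exact msTruncClosed_of (hk2.le.trans hkap) hA
    (statementAReal_of_routeWReal h4 (by norm_num)) hη hB p hp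

/-- **Scalar column (`s = 0`, `μ = 1`), closed half-plane, real axis by route W.** Twin of
`msTruncClosedScalar_ofA_310`. [cite: CasalsTeixeiradacosta2022, Theorem 3.10 (second bullet)] -/
theorem msTruncClosedScalar_ofA_routeWReal {B : Set (ℝ × ℝ × ℝ)} {T : WindowTable} {η : ℝ}
    {Λs : ℝ → ℝ → ℂ → ℝ → Set ℂ}
    (hA : StatementAScalar B T) (h4 : WindowConstants B T) (h4s : WindowConstantsScalar B T)
    (hη : 0 ≤ η) (hB : StatementBbarScalar B T η Λs) : MSTruncClosedScalar B T Λs := by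
  have hAr := statementAReal_of_routeWReal (s := 0) h4 (by norm_num)
  have hA0 := statementARealZero_of_routeWReal h4
  intro p hp ω m hq hk lam hlam R hR
  obtain ⟨him, hm⟩ := hq
  by_cases hw : ω ∈ windowClosedScalar T m
  · exact hB p hp ω m ⟨hm, windowClosedScalar_subset_windowBarScalar T hη m hw⟩ hk lam (hlam hw) R hR
  · rcases him.lt_or_eq with hpos | hzero
    · have hw' : ω ∉ windowScalar T m := fun h => hw (windowScalar_subset_windowClosedScalar T m h)
      exact hA p hp ω m ⟨hpos, hm, hw'⟩ hk ⟨lam, R, hR⟩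
    · by_cases hm0 : m = 0
      · exact hA0 p hp ω m ⟨hzero.symm, hm0⟩ hk ⟨lam, R, hR⟩
      · obtain ⟨hsub, hapos, -⟩ := h4 p hp
        have hh0 : 0 ≤ T.h0 m :=
          (mul_pos (abs_pos.mpr hm0) (superradiantUpper_pos hsub hapos)).le.trans (h4s p hp m hm hm0)
        have hre : T.R m < |ω.re| := by
          by_contra hle
          exact hw ⟨hm0, not_lt.mp hle, him, by rw [← hzero]; exact hh0⟩
        exact hAr p hp ω m ⟨hzero.symm, hm, hre⟩ hk ⟨lam, R, hR⟩

/-- **B0, closed half-plane, real axis by route W:** `B0TheoremClosed` from the two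
Statement A's of B0 (abstract; supplied by the `_routeW` substrate of `RouteWRebind.lean`), rung R2
and the signed records R3. Twin of `b0TheoremClosed_ofA_310`.
[cite: CasalsTeixeiradacosta2022, Theorem 3.10 (second bullet)] -/
theorem b0TheoremClosed_ofA_routeWReal
    (hA : StatementA B0 tableB0) (hAs : StatementAScalar B0 tableB0)
    (hR3 : R3_B0Certificates) : B0TheoremClosed :=
  ⟨msTruncClosed_ofA_routeWReal hA r2_windowConstantsB0.1 (by norm_num) hR3.1,
    msTruncClosedScalar_ofA_routeWReal hAs r2_windowConstantsB0.1 r2_windowConstantsB0.2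
      (by norm_num) hR3.2⟩

section Wave

variable {ts : List CertTile}

/-- **MS_trunc on the closed half-plane (`s = -2`) on every tile, real axis by route W**, given each
tile's Statement A, window constants and DATA binder. Twin of `msTruncClosed_atlas_ofA_310`.
[cite: CasalsTeixeiradacosta2022, Theorem 3.10 (second bullet)] -/
theorem msTruncClosed_atlas_ofA_routeWReal
    (hA : ∀ t ∈ ts, StatementA t.tile.box t.T) (hWC : ∀ t ∈ ts, WindowConstants t.tile.box t.T)
    (hη : ∀ t ∈ ts, 0 ≤ t.eta) (hdata : ∀ t ∈ ts, t.Data) :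
    ∀ t ∈ ts, MSTruncClosed t.tile.box t.T t.lam :=
  fun t ht => msTruncClosed_ofA_routeWReal (hA t ht) (hWC t ht) (hη t ht)
    (t.statementBbar (hdata t ht))

/-- **The displayed wave theorem on the closed half-plane, pointwise form (`s = -2`), real axis by
route W.** Twin of `noModeClosed_atlas_ofA_310`. [cite: CasalsTeixeiradacosta2022, Theorem 3.10 (second bullet)] -/
theorem noModeClosed_atlas_ofA_routeWReal
    (hA : ∀ t ∈ ts, StatementA t.tile.box t.T) (hWC : ∀ t ∈ ts, WindowConstants t.tile.box t.T)
    (hη : ∀ t ∈ ts, 0 ≤ t.eta) (hdata : ∀ t ∈ ts, t.Data) :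
    ∀ p ∈ atlas ts, ∃ t ∈ ts, p ∈ t.tile.box ∧
      NoModeWith p.1 p.2.1 p.2.2 (-2) {q | 0 ≤ q.1.im ∧ |q.2| ≤ 2}
        (fun ω m => {lam | ω ∈ windowClosed t.T m → lam ∈ t.lam p.2.1 p.2.2 ω m}) := by
  rintro p ⟨t, ht, hp⟩
  exact ⟨t, ht, hp, msTruncClosed_atlas_ofA_routeWReal hA hWC hη hdata t ht p hp⟩

end Wave


/-! ### The assembled `_routeWReal` twins: NO cited fact anywhere (open half-plane by
`RouteWRebind.lean`'s `statementA_routeW` / `statementAScalar_routeW`, real axis by route W) -/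

/-- **`s = -2`, closed half-plane, NO cited fact:** `MSTruncClosed` from the window constants (H4)
and the records' Statement B̄ (`η ≥ 0`) alone. Twin of `msTruncClosed_routeW` with `h1` deleted.
[cite: CasalsTeixeiradacosta2022, Theorem 3.10] -/
theorem msTruncClosed_routeWReal {B : Set (ℝ × ℝ × ℝ)} {T : WindowTable} {η : ℝ}
    {Λs : ℝ → ℝ → ℂ → ℝ → Set ℂ} (h4 : WindowConstants B T) (hη : 0 ≤ η)
    (hB : StatementBbar B T η Λs) : MSTruncClosed B T Λs :=
  msTruncClosed_ofA_routeWReal (statementA_routeW h4) h4 hη hB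

/-- **Scalar column, closed half-plane, NO cited fact.** Twin of `msTruncClosedScalar_routeW` with
`h1` deleted. [cite: CasalsTeixeiradacosta2022, Theorem 3.10] -/
theorem msTruncClosedScalar_routeWReal {B : Set (ℝ × ℝ × ℝ)} {T : WindowTable} {η : ℝ}
    {Λs : ℝ → ℝ → ℂ → ℝ → Set ℂ} (h4 : WindowConstants B T) (h4s : WindowConstantsScalar B T)
    (hη : 0 ≤ η) (hB : StatementBbarScalar B T η Λs) : MSTruncClosedScalar B T Λs :=
  msTruncClosedScalar_ofA_routeWReal (statementAScalar_routeW h4 h4s) h4 h4s hη hB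

/-- **THE CLOSED-HALF-PLANE B0 THEOREM FROM THE CERTIFICATES ALONE** — twin of
`b0TheoremClosed_of_certificates_310` / `b0TheoremClosed_routeW` with `h1` (and `h3`) deleted:
`B0TheoremClosed` from the signed records R3 (rung R2, the angular sign H2, route W on the open
half-plane and on the real axis are all theorems of this tree). [cite: CasalsTeixeiradacosta2022, Theorem 3.10] -/
theorem b0TheoremClosed_routeWReal (hR3 : R3_B0Certificates) : B0TheoremClosed :=
  b0TheoremClosed_ofA_routeWReal (statementA_routeW r2_windowConstantsB0.1)
    (statementAScalar_routeW r2_windowConstantsB0.1 r2_windowConstantsB0.2) hR3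

section WaveClosedReal

variable {ts : List CertTile}

/-- **MS_trunc on the closed half-plane (`s = -2`) on every tile, NO cited fact.** Twin of
`msTruncClosed_atlas_routeW` with `h1` deleted. [cite: CasalsTeixeiradacosta2022, Theorem 3.10] -/
theorem msTruncClosed_atlas_routeWReal (hWC : ∀ t ∈ ts, WindowConstants t.tile.box t.T)
    (hη : ∀ t ∈ ts, 0 ≤ t.eta) (hdata : ∀ t ∈ ts, t.Data) :
    ∀ t ∈ ts, MSTruncClosed t.tile.box t.T t.lam :=
  msTruncClosed_atlas_ofA_routeWReal (fun t ht => statementA_routeW (hWC t ht)) hWC hη hdata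

/-- **THE DISPLAYED WAVE THEOREM ON THE CLOSED HALF-PLANE (`s = -2`), NO CITED FACT** — twin of
`noModeClosed_atlas_routeW` with `h1` deleted: for every parameter point of the atlas there is a tile
containing it on which there is NO mode with `Im ω ≥ 0` (real axis and `ω = 0` included), `|m| ≤ 2`,
whose separation constant lies in the tile's λ-family when `ω` is in the tile's closed window — given
the kernel-checked window constants and the DATA only. [cite: CasalsTeixeiradacosta2022, Theorem 3.10] -/
theorem noModeClosed_atlas_routeWReal (hWC : ∀ t ∈ ts, WindowConstants t.tile.box t.T)
    (hη : ∀ t ∈ ts, 0 ≤ t.eta) (hdata : ∀ t ∈ ts, t.Data) :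
    ∀ p ∈ atlas ts, ∃ t ∈ ts, p ∈ t.tile.box ∧
      NoModeWith p.1 p.2.1 p.2.2 (-2) {q | 0 ≤ q.1.im ∧ |q.2| ≤ 2}
        (fun ω m => {lam | ω ∈ windowClosed t.T m → lam ∈ t.lam p.2.1 p.2.2 ω m}) :=
  noModeClosed_atlas_ofA_routeWReal (fun t ht => statementA_routeW (hWC t ht)) hWC hη hdata

end WaveClosedReal

end Summit.Ventures.KdS

end
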